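import Summits.Ventures.GridStability.Bench.WSCC9Deg2ARecertDV2SPdampH12Roa
import Summits.Ventures.GridStability.Bench.WSCC9Deg2ASPdampH12RoaModel
import Summits.Ventures.GridStability.Lyapunov.RecastAngleRecovery
import Summits.Ventures.GridStability.Models.WSCC9
import Mathlib.Analysis.SpecialFunctions.Trigonometric.Deriv
import Mathlib.Tactic.IntervalCases
import HarnessLib

/-!
# «G1.b-fault-coverage-2»-roa (model half) — no pole slip and return to synchronism FOR model-1's `WSCC9.postB_SPdamp.toModel`
# from the D-type certificate `Bench/WSCC9Deg2ARecertDV2SPdampH12`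

Venture GRIDFUSION, `plan/PARTITION.md` A2/A5/A6 + A10 (improvement row «G1.b-fault-coverage-2»); seat
gridfusion-sos-3 (g2). Sibling of `WSCC9Deg2ARecertDV2SPdampH12Roa.lean` (recast half), which it imports.
It is the SAME MODEL, the SAME instance `WSCC9.postB_SPdamp : RecastData 2` (`Models/WSCC9.lean`) and the SAME
exact embedding as the file-of-record companion `WSCC9Deg2ASPdampH12RoaModel.lean` (gridfusion-lyap-1, p468745),
so — instead of restating them — this file IMPORTS that companion and REUSES its embedding vocabulary VERBATIM
(`deg2_A_SPdampH12_Z`, `deg2_A_SPdampH12_Z_k`, `deg2_A_SPdampH12_embed_k`, `deg2_A_SPdampH12_M_ne_zero`,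
`deg2_A_SPdampH12_hasDerivWithinAt_Z`, `deg2_A_SPdampH12_Z_mem_M`); the only new facts are that the two Bench
files carry the same recast field and the same constraint set (`…_F_eq_F`, `…_M_eq_M`: both are model-1's
`WSCC9.postB_SPdamp.polyField` / constraints VERBATIM, interface I2 — checked here by `ring` on the emitted
`_eq` lemmas), and the model-level reading of the D-type certificate's larger sublevel piece.

THREE COLUMNS. CERTIFIED: the Bench identities of `WSCC9Deg2ARecertDV2SPdampH12` (A 84aff50cc1f2fbb9 re-cert of
sos-3's claim instance v2 1f258400; consumed through `deg2_A_recertD_v2_SPdampH12_roa`). MODELLED: every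
theorem here is about model-1's classical 3-machine model `WSCC9.postB_SPdamp.toModel` (`ClassicalSwing.field`:
Anderson–Fouad (2.55)–(2.57) / Sauer–Pai (7.212)–(7.216) + speed damping (5.157), deviation coordinates, exact
rational data of instance WSCC9-postB-SPdamp-h12; MODEL-VALIDITY MV-2+MV-P+MV-SPD+MV-ω+MV-h12: network-reduced
with constant-impedance loads, classical machines, uniform-ratio damping DECLARED, post-fault synchronous speed
offset ω∞′) for equilibrium angles `δs` with `WSCC9.postB_SPdamp.EqData δs`. VALIDATED (not in this file; HOME
bench/G1-LOG.md §6/§11): this piece contains the post-fault initial state of Anderson–Fouad's bus-7 fault and the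
fault-on trajectory up to t* = 0.114 s ≥ the printed 0.083 s clearing (simulated CCT 0.176 s). No sentence here
says a grid is stable; «return to synchronism» below is a statement about solutions OF THE MODEL M′.

STATEMENT (`deg2_A_recertD_v2_SPdampH12_model_roa`): for every `0 < γ ≤ 61931/50000` and every solution `c` of
the model on `[0, ∞)` whose recast initial state satisfies `V ≤ γ` and whose initial relative-angle deviations
satisfy `|u_i(0)| < π`: `V ≤ γ` along the recast state for all `t ≥ 0`; no relative angle deviation ever
reaches `±π` (no pole slip; in fact `cos u_i ≥ −1/2`); every `u_i(t) → 0` and every speed deviation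
`ω_j(t) → 0`. Existence of global solutions is not restated (Literature.Analysis.ODE, p458002).
-/

namespace Summit.Ventures.GridStability.Bench.WSCC9

open Set Filter Metric Topology Real
open Summit.Ventures.GridStability.Lyapunov Summit.Ventures.GridStability.Models
open Literature.Computation.Certificates Literature.Computation.Certificates.SOS

noncomputable section

/-- The two Bench files of the instance carry the SAME recast field (both = model-1's
`WSCC9.postB_SPdamp.polyField` verbatim): `deg2_A_recertD_v2_SPdampH12_F = deg2_A_SPdampH12_F`. [folklore] -/
theorem deg2_A_recertD_v2_SPdampH12_F_eq_F : deg2_A_recertD_v2_SPdampH12_F = deg2_A_SPdampH12_F := by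
  funext z i
  fin_cases i <;>
    simp [deg2_A_recertD_v2_SPdampH12_F, deg2_A_SPdampH12_F,
      deg2_A_recertD_v2_SPdampH12_f_sigma_2_eq, deg2_A_recertD_v2_SPdampH12_f_kappa_2_eq,
      deg2_A_recertD_v2_SPdampH12_f_sigma_3_eq, deg2_A_recertD_v2_SPdampH12_f_kappa_3_eq,
      deg2_A_recertD_v2_SPdampH12_f_omega_1_eq, deg2_A_recertD_v2_SPdampH12_f_omega_2_eq,
      deg2_A_recertD_v2_SPdampH12_f_omega_3_eq,
      deg2_A_SPdampH12_f_sigma_2_eq, deg2_A_SPdampH12_f_kappa_2_eq, deg2_A_SPdampH12_f_sigma_3_eq,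
      deg2_A_SPdampH12_f_kappa_3_eq, deg2_A_SPdampH12_f_omega_1_eq, deg2_A_SPdampH12_f_omega_2_eq,
      deg2_A_SPdampH12_f_omega_3_eq]

/-- … and the SAME constraint set `{h₁ = 0, h₂ = 0}`:
`deg2_A_recertD_v2_SPdampH12_M = deg2_A_SPdampH12_M`. [folklore] -/
theorem deg2_A_recertD_v2_SPdampH12_M_eq_M : deg2_A_recertD_v2_SPdampH12_M = deg2_A_SPdampH12_M := by
  ext z
  simp only [deg2_A_recertD_v2_SPdampH12_M, deg2_A_SPdampH12_M, mem_setOf_eq,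
    deg2_A_recertD_v2_SPdampH12_h1_eq, deg2_A_recertD_v2_SPdampH12_h2_eq, deg2_A_SPdampH12_h1_eq,
    deg2_A_SPdampH12_h2_eq]

/-- **Exact embedding along solutions of the model `M′`** for THIS Bench field: the recast curve
`t ↦ Z δs (c t)` (lyap-1's `deg2_A_SPdampH12_Z`, = model-1's `RecastData.embed`) solves `ż = F(z)` with
`deg2_A_recertD_v2_SPdampH12_F` — from the file-of-record companion's `deg2_A_SPdampH12_hasDerivWithinAt_Z`
(faithfulness `fk_eval_k` proved there by `decide` on `Poly.norm`) and `…_F_eq_F`. [folklore] -/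
theorem deg2_A_recertD_v2_SPdampH12_hasDerivWithinAt_Z {δs : Fin 3 → ℝ} (hEq : WSCC9.postB_SPdamp.EqData δs)
    {c : ℝ → ClassicalSwing.State 3} {s : Set ℝ} (hc : WSCC9.postB_SPdamp.toModel.IsSolutionOn c s)
    {t : ℝ} (ht : t ∈ s) :
    HasDerivWithinAt (fun τ ↦ deg2_A_SPdampH12_Z δs (c τ))
      (deg2_A_recertD_v2_SPdampH12_F (deg2_A_SPdampH12_Z δs (c t))) s t := by
  rw [deg2_A_recertD_v2_SPdampH12_F_eq_F]
  exact deg2_A_SPdampH12_hasDerivWithinAt_Z hEq hc ht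

/-- The recast coordinates of any state lie on THIS file's constraint set `M`. [folklore] -/
theorem deg2_A_recertD_v2_SPdampH12_Z_mem_M (δs : Fin 3 → ℝ) (x : ClassicalSwing.State 3) :
    deg2_A_SPdampH12_Z δs x ∈ deg2_A_recertD_v2_SPdampH12_M := by
  rw [deg2_A_recertD_v2_SPdampH12_M_eq_M]
  exact deg2_A_SPdampH12_Z_mem_M δs x

/-- **«G1.b-fault-coverage-2»-roa in original coordinates (3-machine WSCC9), with angle recovery (A6).**
MODELLED: model-1's classical model `WSCC9.postB_SPdamp.toModel` (`ClassicalSwing.field`, deviation coordinates;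
MV-2+MV-P+MV-SPD+MV-ω+MV-h12) for equilibrium angles `δs` satisfying the A1′ relations
`WSCC9.postB_SPdamp.EqData δs`. CERTIFIED inputs: the kernel-checked identities of the D-type Bench file
(consumed by `deg2_A_recertD_v2_SPdampH12_roa`). STATEMENT: for every `0 < γ ≤ c = 61931/50000` and every
solution `c(t)` on `[0, ∞)` whose recast initial state has `V ≤ γ` and whose initial relative-angle deviations
satisfy `|u_i(0)| < π`: `V ≤ γ` along the recast state for all `t ≥ 0`; NO relative angle ever reaches `±π`
(no pole slip); every `u_i(t) → 0` and every speed deviation `ω_j(t) → 0` (return to synchronism at the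
equilibrium `δs`). No sentence here says a grid is stable. [folklore] -/
theorem deg2_A_recertD_v2_SPdampH12_model_roa {δs : Fin 3 → ℝ} (hEq : WSCC9.postB_SPdamp.EqData δs)
    {γ : ℝ} (hγ0 : 0 < γ) (hγ : γ ≤ deg2_A_recertD_v2_SPdampH12_level)
    {c : ℝ → ClassicalSwing.State 3} (hc : WSCC9.postB_SPdamp.toModel.IsSolutionOn c (Ici 0))
    (h0V : deg2_A_recertD_v2_SPdampH12_Vz (deg2_A_SPdampH12_Z δs (c 0)) ≤ γ)
    (h0win : ∀ i : Fin 2, |RecastData.u δs (c 0) i.succ| < π) :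
    (∀ t, 0 ≤ t → deg2_A_recertD_v2_SPdampH12_Vz (deg2_A_SPdampH12_Z δs (c t)) ≤ γ) ∧
    (∀ i : Fin 2, ∀ t, 0 ≤ t → |RecastData.u δs (c t) i.succ| < π) ∧
    (∀ i : Fin 2, Tendsto (fun t ↦ RecastData.u δs (c t) i.succ) atTop (𝓝 0)) ∧
    (∀ j : Fin 3, Tendsto (fun t ↦ (c t).2 j) atTop (𝓝 0)) := by
  set z : ℝ → Fin 7 → ℝ := fun τ ↦ deg2_A_SPdampH12_Z δs (c τ) with hzdef
  have hcc : ContinuousOn c (Ici 0) := fun t ht ↦ (hc t ht).continuousWithinAt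
  have hzc : ContinuousOn z (Ici 0) := by
    have h : Continuous fun x : ClassicalSwing.State 3 ↦ deg2_A_SPdampH12_Z δs x := by
      refine continuous_pi fun k ↦ ?_
      fin_cases k <;> simp [deg2_A_SPdampH12_Z_0, deg2_A_SPdampH12_Z_1, deg2_A_SPdampH12_Z_2,
        deg2_A_SPdampH12_Z_3, deg2_A_SPdampH12_Z_4, deg2_A_SPdampH12_Z_5, deg2_A_SPdampH12_Z_6,
        RecastData.u] <;> fun_prop
    exact h.comp_continuousOn hcc
  have hz : ∀ t, 0 ≤ t → HasDerivWithinAt z (deg2_A_recertD_v2_SPdampH12_F (z t)) (Ici t) t := fun t ht ↦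
    (deg2_A_recertD_v2_SPdampH12_hasDerivWithinAt_Z hEq hc ht).mono (Ici_subset_Ici.2 ht)
  obtain ⟨hinv, hlim⟩ := deg2_A_recertD_v2_SPdampH12_roa hγ0 hγ hzc hz
    (deg2_A_recertD_v2_SPdampH12_Z_mem_M δs (c 0)) h0V
  -- per-coordinate limits of model-1's `embed`
  have hlim' : ∀ k : ℕ, k < 7 → Tendsto (fun t ↦ RecastData.embed δs (c t) k) atTop (𝓝 0) := by
    intro k hk
    have hall := tendsto_pi_nhds.1 hlim
    interval_cases k
    · simpa [hzdef, deg2_A_SPdampH12_embed_0] using hall 0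
    · simpa [hzdef, deg2_A_SPdampH12_embed_1] using hall 1
    · simpa [hzdef, deg2_A_SPdampH12_embed_2] using hall 2
    · simpa [hzdef, deg2_A_SPdampH12_embed_3] using hall 3
    · simpa [hzdef, deg2_A_SPdampH12_embed_4] using hall 4
    · simpa [hzdef, deg2_A_SPdampH12_embed_5] using hall 5
    · simpa [hzdef, deg2_A_SPdampH12_embed_6] using hall 6
  -- arc bounds `κ_i ≤ 3/2 < 2` along the curve (from the certified INCLUSION identities dom_incl_0/1)
  have hκ : ∀ i : Fin 2, ∀ t, 0 ≤ t → RecastData.embed δs (c t) (2 * i.val + 1) < 2 := by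
    intro i t ht
    obtain ⟨-, harc⟩ := hinv t ht
    fin_cases i
    · have h := harc
      simp only [hzdef, deg2_A_SPdampH12_Z_1, deg2_A_SPdampH12_Z_3] at h
      show RecastData.embed δs (c t) 1 < 2
      rw [deg2_A_SPdampH12_embed_1]
      linarith [h.1]
    · have h := harc
      simp only [hzdef, deg2_A_SPdampH12_Z_1, deg2_A_SPdampH12_Z_3] at h
      show RecastData.embed δs (c t) 3 < 2
      rw [deg2_A_SPdampH12_embed_3]
      linarith [h.2]
  have hrec := recast_angle_recovery δs hcc hlim' hκ h0win
  exact ⟨fun t ht ↦ (hinv t ht).1, hrec.1, hrec.2.1, hrec.2.2⟩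

end

end Summit.Ventures.GridStability.Bench.WSCC9
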